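import Literature.AlgebraicGeometry.AbelianSchemes.WeilUnitDualIsogeny         -- ★ `weilUnit_comp_dualIsogenyOver` (p846799)
import Literature.AlgebraicGeometry.AbelianSchemes.WeilUnitMulRight            -- ★ `weilUnit_mul_right`
import HarnessLib

/-!
# Kernels and dual images are orthogonal for the Weil unit: `e_n^A(Ker φ, φ^∨ B̂[n]) = 1` and `e_n^B(φ A[n], Ker φ^∨) = 1`
# ([Mumford AV] §20 (I) p. 186, (IV) p. 187; [Milne AV] I §11)

Topic `Literature/AlgebraicGeometry/AbelianSchemes`; namespace `Literature.AlgebraicGeometry.AbelianSchemes.AbelianSchemeOver.DualPair`.  THEOREMS ONLY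
(no `def`, no named fact, no instance, no notation, no `sorry`).  Cell `hodgecm-mathlib` (D-0151), FLOOR 0, P6 «MOD programme» (crux hLiu418 =
stmt-HodgeConjecture-24832), sub-desk P6b «BT groups & Serre–Tate ∕ Lubin–Tate», organ deal (β2)∕(E2-iso) «kernel of a polarised isogeny is
isotropic» of the `w`-block dock (memo `F0/P6/F0P6b-plan/g3/MEMO-ED2-Docking-rL-wBlock.v1.F0P6b-plan-g3.md` §2; LEAD F0P6-plan (g2) rulings
20:52:23Z (β) and 21:06:35Z (4) (P1′)) — the CHEAP, UNCONDITIONAL HALF in the `weilUnit` costume of ★ `WeilUnitOfTorsionPoint`: the kernel of a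
homomorphism pairs trivially with the image of the dual homomorphism on torsion points, and symmetrically.  HC_CM is proved only modulo the printed
citations until rung 0 closes; nothing here is about HC.

THE PRINT.  [MumfordAV1970] §20 p. 186, property (I) of `e_n : X_n × X̂_n → μ_n`: `e_n(f x, y) = e_n(x, f̂ y)`; with (IV) (p. 187: `e_n(1, y) = 1 =
e_n(x, 1)`, bi-multiplicativity) it follows at once that `e_n(x, f̂ y) = 1` whenever `f x = 0` and `e_n(f x, y) = 1` whenever `f̂ y = 0` — the two
orthogonality relations behind the perfect pairing `e_f : Ker f × Ker f̂ → 𝔾_m` of [MumfordAV1970] §15 Thm. 1 (p. 143) ∕ [MilneAV2008] I §11.  Here,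
scheme-theoretically over a test scheme `T → S` (`S` reduced, locally Noetherian; dual pairs `(Â, 𝒫_A)`, `(B̂, 𝒫_B)` with the unit hypotheses `hDA`,
`hDB`; `φ^∨ := dualIsogenyOver φ DA DB`), for an `n`-torsion section `x` of `A_T` and an `n`-torsion `T`-point `c` of `B̂`.

WHAT IS HERE (over ★ `weilUnit_comp_dualIsogenyOver`, ★ `weilUnit_one`, ★ `weilUnit_mul_right`, ★ `weilUnit_inv_mul`):
* §1 `weilUnit_congr_point` (the Weil unit depends on the point `c`, not on the torsion witness), **`weilUnit_one_right`** — `e_n(x, 1) = 1`;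
* §2 **`weilUnit_comp_dualIsogenyOver_eq_one_of_comp_baseChangeHom_eq_one`** — `φ_T x = 1 ⇒ e_n^A(x, φ^∨ c) = 1` («`Ker φ ⟂ φ^∨(B̂[n])`»);
* §3 **`weilUnit_image_eq_one_of_comp_dualIsogenyOver_eq_one`** — `c ≫ φ^∨ = 1 ⇒ e_n^B(φ_T x, c) = 1` («`φ(A[n]) ⟂ Ker φ^∨`»).

NOT HERE (priced separately for the LEAD): the FULL isotropy of `Ker f ∩ A[q]` for a polarised isogeny `f` with `f ≫ λ_B ≫ f^∨ = λ ≫ [p]` under the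
`λ`-twisted pairing — that is the descent theorem [MumfordAV1970] §23 Thm. 2 + Cor. (pp. 231–233: `K ⊂ K(L)` admits a level subgroup iff `e^L ≡ 1`
on `K × K`), theta-group sized; §2 gives it exactly when `λ (Ker f ∩ A[q]) ⊆ φ^∨ (B̂[q])` on `T`-points.

## References
* [MumfordAV1970] D. Mumford, *Abelian Varieties* (1970), §20 (pp. 184–187, properties (I), (IV)), §15 Thm. 1 (p. 143), §23 (pp. 231–233).
* [MilneAV2008] J. S. Milne, *Abelian Varieties* (2008), I §11 (the `e_m`-pairing and its functoriality).
-/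

set_option autoImplicit false

noncomputable section

-- `TopCat.Presheaf`/`Scheme.Modules` are not reducible (as in Mathlib's `AlgebraicGeometry/Modules` and ★ `WeilUnitOfTorsionPoint`, ★ `WeilUnitDualIsogeny`).
set_option backward.isDefEq.respectTransparency false

universe u

open CategoryTheory CategoryTheory.Limits AlgebraicGeometry MonoidalCategory CartesianMonoidalCategory TopologicalSpace
  Opposite
open scoped MonObj

namespace Literature.AlgebraicGeometry.AbelianSchemes.AbelianSchemeOver.DualPair

open TorsionPairing Literature.AlgebraicGeometry.RelativeSpec Literature.AlgebraicGeometry.Modules Literature.AlgebraicGeometry.Motives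
  Literature.AlgebraicGeometry.RelativeSpec.ActionOver

/-! ## §1 `e_n(x, 1) = 1` -/

section OneRight

variable {S : Scheme.{u}} {A : AbelianSchemeOver S} [IsReduced S] [IsLocallyNoetherian S] (D : A.DualPair)
  (hD : Nonempty ((Scheme.Modules.pullback (DualPair.unitHatSlice D)).obj D.P ≅ SheafOfModules.unit _)) (n : ℕ)
  {T : Scheme.{u}} (f : T ⟶ S) [IsLocallyNoetherian T] [IsCommMonObj (A.baseChange f).X]

/-- The Weil unit depends on the `n`-torsion POINT `c` of `Â`, not on the chosen torsion witness: equal points give equal units.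
[cite: MumfordAV1970, §20 (p. 184)] -/
theorem weilUnit_congr_point {c₁ c₂ : Over.mk f ⟶ D.hat.X} (h : c₁ = c₂) (hc₁ : c₁ ^ n = 1) (hc₂ : c₂ ^ n = 1)
    (g : (A.baseChange f).torsionSections n) : D.weilUnit hD n f c₁ hc₁ g = D.weilUnit hD n f c₂ hc₂ g := by
  subst h
  rfl

/-- **`e_n(x, 1) = 1`** — the Weil unit of any `n`-torsion section against the UNIT point of `Â` is `1`: by ★ `weilUnit_mul_right` at `ŷ₁ = ŷ₂ = 1`,
`u := e_n(x, 1)` satisfies `u = u · u`, and `u` is a unit (★ `weilUnit_inv_mul`). [cite: MumfordAV1970, §20 (IV) (p. 187)] [cite: MilneAV2008, I §11] -/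
theorem weilUnit_one_right (h1 : (1 : Over.mk f ⟶ D.hat.X) ^ n = 1) (g : (A.baseChange f).torsionSections n) :
    D.weilUnit hD n f 1 h1 g = 1 := by
  have h11 : ((1 : Over.mk f ⟶ D.hat.X) * 1) ^ n = 1 := by rw [mul_one]; exact h1
  have hmul := D.weilUnit_mul_right hD n f 1 1 h1 h1 h11 g
  rw [D.weilUnit_congr_point hD n f (mul_one (1 : Over.mk f ⟶ D.hat.X)) h11 h1 g] at hmul
  -- `u = u * u` with `u` a unit forces `u = 1`.
  have hunit : D.weilUnit hD n f 1 h1 g⁻¹ * D.weilUnit hD n f 1 h1 g = 1 := D.weilUnit_inv_mul hD n f 1 h1 g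
  calc D.weilUnit hD n f 1 h1 g
      = (D.weilUnit hD n f 1 h1 g⁻¹ * D.weilUnit hD n f 1 h1 g) * D.weilUnit hD n f 1 h1 g := by rw [hunit, one_mul]
    _ = D.weilUnit hD n f 1 h1 g⁻¹ * (D.weilUnit hD n f 1 h1 g * D.weilUnit hD n f 1 h1 g) := by rw [mul_assoc]
    _ = D.weilUnit hD n f 1 h1 g⁻¹ * D.weilUnit hD n f 1 h1 g := by rw [← hmul]
    _ = 1 := hunit

end OneRight

/-! ## §2 `Ker φ ⟂ φ^∨(B̂[n])`: `φ_T x = 1 ⇒ e_n^A(x, φ^∨ c) = 1` -/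

section Kernel

variable {S : Scheme.{u}} {A B : AbelianSchemeOver S} [IsReduced S] [IsLocallyNoetherian S] (φ : A.X ⟶ B.X) [IsMonHom φ]
  (DA : A.DualPair) (DB : B.DualPair)
  (hDA : Nonempty ((Scheme.Modules.pullback (DualPair.unitHatSlice DA)).obj DA.P ≅ SheafOfModules.unit _))
  (hDB : Nonempty ((Scheme.Modules.pullback (DualPair.unitHatSlice DB)).obj DB.P ≅ SheafOfModules.unit _)) (n : ℕ)
  {T : Scheme.{u}} (f : T ⟶ S) [IsLocallyNoetherian T] [IsCommMonObj (A.baseChange f).X] [IsCommMonObj (B.baseChange f).X]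

include hDB in
/-- **`Ker φ ⟂ φ^∨(B̂[n])` — THE KERNEL OF `φ` PAIRS TRIVIALLY WITH THE `φ^∨`-IMAGE OF `B̂[n]`**: for an `n`-torsion `T`-point `c` of `B̂` and an
`n`-torsion section `x` of `A_T` KILLED BY `φ_T`, `e_n^A(x, φ^∨ c) = e_n^B(φ_T x, c) = e_n^B(1, c) = 1` (★ `weilUnit_comp_dualIsogenyOver`, ★
`weilUnit_one`).  The torsion witness `hc'` of `c ≫ φ^∨` is a free hypothesis (under the unit hypotheses it is ★ `pow_comp_dualIsogenyOver_eq_one`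
with ★ `isMonHom_dualIsogenyOver φ DA DB hDB hDA`). [cite: MumfordAV1970, §20 (I) (p. 186), (IV) (p. 187)] [cite: MilneAV2008, I §11] -/
theorem weilUnit_comp_dualIsogenyOver_eq_one_of_comp_baseChangeHom_eq_one (c : Over.mk f ⟶ DB.hat.X) (hc : c ^ n = 1)
    (hc' : (c ≫ dualIsogenyOver φ DA DB) ^ n = 1) (x : (A.baseChange f).torsionSections n)
    (hx : (x : (A.baseChange f).Sections) ≫ baseChangeHom φ f = 1) :
    DA.weilUnit hDA n f (c ≫ dualIsogenyOver φ DA DB) hc' x = 1 := by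
  rw [weilUnit_comp_dualIsogenyOver φ DA DB hDA hDB n f c hc hc' x]
  have h1 : (⟨(x : (A.baseChange f).Sections) ≫ baseChangeHom φ f, comp_baseChangeHom_pow_eq_one φ n f x⟩ :
      (B.baseChange f).torsionSections n) = 1 := Subtype.ext hx
  rw [h1]
  exact DB.weilUnit_one hDB n f c hc

include hDB in
/-- The same with the torsion witness of `c ≫ φ^∨` DISCHARGED under the unit hypotheses (★ `isMonHom_dualIsogenyOver`), as an existential over the
witness so that it rewrites at whatever proof the consumer holds. [cite: MumfordAV1970, §20 (I) (p. 186)] -/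
theorem weilUnit_comp_dualIsogenyOver_eq_one_of_comp_baseChangeHom_eq_one' (c : Over.mk f ⟶ DB.hat.X) (hc : c ^ n = 1)
    (x : (A.baseChange f).torsionSections n) (hx : (x : (A.baseChange f).Sections) ≫ baseChangeHom φ f = 1) :
    ∀ hc' : (c ≫ dualIsogenyOver φ DA DB) ^ n = 1, DA.weilUnit hDA n f (c ≫ dualIsogenyOver φ DA DB) hc' x = 1 :=
  fun hc' => weilUnit_comp_dualIsogenyOver_eq_one_of_comp_baseChangeHom_eq_one φ DA DB hDA hDB n f c hc hc' x hx

/-! ## §3 `φ(A[n]) ⟂ Ker φ^∨`: `c ≫ φ^∨ = 1 ⇒ e_n^B(φ_T x, c) = 1` -/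

include hDA in
/-- **`φ(A[n]) ⟂ Ker φ^∨` — THE `φ_T`-IMAGE OF `A_T[n]` PAIRS TRIVIALLY WITH THE KERNEL OF `φ^∨`**: for an `n`-torsion `T`-point `c` of `B̂` KILLED BY
`φ^∨` and any `n`-torsion section `x` of `A_T`, `e_n^B(φ_T x, c) = e_n^A(x, φ^∨ c) = e_n^A(x, 1) = 1` (★ `weilUnit_comp_dualIsogenyOver` backwards,
`weilUnit_one_right`). [cite: MumfordAV1970, §20 (I) (p. 186), (IV) (p. 187)] [cite: MilneAV2008, I §11] -/
theorem weilUnit_image_eq_one_of_comp_dualIsogenyOver_eq_one (c : Over.mk f ⟶ DB.hat.X) (hc : c ^ n = 1)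
    (hcφ : c ≫ dualIsogenyOver φ DA DB = 1) (x : (A.baseChange f).torsionSections n) :
    DB.weilUnit hDB n f c hc ⟨(x : (A.baseChange f).Sections) ≫ baseChangeHom φ f, comp_baseChangeHom_pow_eq_one φ n f x⟩ = 1 := by
  have hc' : (c ≫ dualIsogenyOver φ DA DB) ^ n = 1 := by rw [hcφ, one_pow]
  have h1 : (1 : Over.mk f ⟶ DA.hat.X) ^ n = 1 := one_pow n
  rw [← weilUnit_comp_dualIsogenyOver φ DA DB hDA hDB n f c hc hc' x, DA.weilUnit_congr_point hDA n f hcφ hc' h1 x]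
  exact DA.weilUnit_one_right hDA n f h1 x

end Kernel

end Literature.AlgebraicGeometry.AbelianSchemes.AbelianSchemeOver.DualPair

end
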